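import Literature.NumberTheory.EllipticCurves.HeegnerPointsKolyvaginSplitDescentTelescopePureProofs
import Summits.BirchSwinnertonDyer.BirchSwinnertonDyer.Theorems.CMKolyvaginAtInertTwoAdaptiveStep
import HarnessLib

/-!
# STATUS (seat g13, 2026-08-29): THIS SPEC IS PROVED — `KolyvaginAdaptiveTwo.card_mul_card_le_of_casselsTate_adaptive`
# (p672541, over `SplitHypothesesM`, VACUOUS at 2: no instance exists, see KERNEL-STATUS §12) and, non-vacuously,
# `KolyvaginAdaptiveData.card_mul_card_le_of_casselsTate_adaptive` (p673519, over the data carrier `SplitDataM`, p672870),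
# instantiated at 2 by `KolyvaginPairDataTwo.pairData` (p675421) with `hΔpure`/`hCeb₂` discharged in
# `KolyvaginPairDataTwo.card_mul_card_le_two_pow_of_pair` (p679105). The `sorry` below is kept only as the historical SPEC text;
# do NOT attack it. Remaining hypotheses: hCTV (T2, KERNEL-STATUS §12.2/§12.3), lift groups (T5′), habitat inputs.
#
# SPEC (crux workfile, `sorry` ALLOWED here — this is NOT a Theorems file) — T4 of
# `MEMO-T5-adaptive-splitting.md`: the ADAPTIVE split-form Cassels–Tate telescope at `p = 2`

Seat `bsd-line-cmk2-p1` g12. Crux `CMKolyvaginExactAtInertTwo` (stmt-BirchSwinnertonDyer-24277).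
This file only FIXES THE STATEMENT the next seat should prove (it elaborates against the tree; the
proof is `sorry`). See KERNEL-STATUS-p2-port.md §11 item 6 and the memo §§1–4.

Differences with gk2's `SplitHypothesesM.sum_expo_le_M₀_of_casselsTate_pure`
(`HeegnerPointsKolyvaginSplitDescentTelescopePureProofs`, McCallum Thm 5.4 "≤" with FIXED lifts `s_i`
and the binder `hCeb`, which is FALSE at `2` as typed):
* a subgroup `Δ ≤ V` of `p`-torsion meeting both eigengroups trivially (at `2` on the pair
  `(E, E^{d_K})`: `Δ_H = ker(V → H¹(K, E[2^M])) = {(jh, j′h)}`; at odd `p`: `Δ = ⊥`);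
* the binder **`hCeb₂`** in ORDER form (what the telescope uses: `⟨T⟩` zero at `λ`, `g₁` of FULL
  local order, `g₂` of local order `≥ p^I` where `I = I_k` is the invariant-(I) bound — NOT the
  kernel form, which over-determines at a slack step): hypotheses = the bottoms condition for `g₁`
  (`p^{expo g₁ − 1} g₁ ∉ Δ ⊔ ⟨T⟩`, if `g₁ ≠ 0`) and the RELATIVE condition for `g₂`
  (`p^{I−1} g₂ ∉ Δ + ⟨T⟩_{−ν} + ⟨T⟩_{ν}[p]`, if `I ≥ 1`; `I = 0` / `g₁ = 0` are dummy steps) — true at `2` by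
  `KolyvaginAdaptiveTwo.exists_characters_of_not_mem_add` (relative criterion, p670347) /
  `KolyvaginAdaptiveTwo.exists_characters_of_bottom_ne_add` (p668236) +
  `KolyvaginImageTwo.exists_kolyvaginPrime_gt_two_pow_of_hom` (p669091) + g10's regular-module
  structure of `E[2^M]` + the local criterion (discharge = T4c);
* the lifts are given as two finite pure isotropic LIFT GROUPS `Zp ≤ Sel ∩ V^{ε}`,
  `Zm ≤ Sel ∩ V^{−ε}`, independent of `ℤx`, satisfying **(IND)** `(Zp ⊔ Δ) ⊓ Zm = ⊥`; the
  generators are chosen INSIDE the proof, adaptively (`KolyvaginAdaptiveTwo.exists_split_not_mem_sup`,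
  p669796, applied in `V ⧸ Δ` at each step of McCallum's induction (16)–(23), invariant (I) as in gk2);
* conclusion `#Zp · #Zm ≤ p^{M₀}` (= `∑ Nᵢ ≤ M₀` for independent generators).
BSD is not proved by this; nothing here is a theorem of the tree.
-/

set_option linter.dupNamespace false
set_option autoImplicit false

open scoped Classical

namespace Literature.NumberTheory.EllipticCurves.KolyvaginDescent.SplitHypothesesM

variable {V : Type*} [AddCommGroup V] {Pl : Type*} (S : SplitHypothesesM V Pl)

/-- **T4 (SPEC): the adaptive split telescope.** McCallum 1991 Thm. 5.4 "≤" / Cor. 5.6 in telescope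
form, split currency, with the `p = 2`-correct Čebotarev binder `hCeb₂` and lift GROUPS satisfying
(IND); see the module docstring. [cite: McCallumLMS1991, §5 Thm. 5.4 (proof, (16)–(23)), Cor. 5.6] -/
theorem card_mul_card_le_of_casselsTate_adaptive {R : Type*} [AddCommGroup R]
    (P : S.Sel →+ S.Sel →+ R)
    (hCTV : ∀ ℓ m : ℕ, S.Kol ℓ → KolSupp S.Kol (ℓ * m) → ¬ ℓ ∣ m →
      ∀ (j N a b : ℕ) (t : V) (ht : t ∈ S.Sel) (hz : ((S.p : ℤ) ^ j) • S.c (ℓ * m) ∈ S.Sel),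
      ((S.p : ℤ) ^ N) • t = 0 → t ∈ S.eig (S.ε * (-1) ^ (ℓ * m).primeFactors.card) →
      (∀ q ∈ m.primeFactors, t ∈ S.A q) → S.M - S.M₀ ≤ j → N + S.M₀ ≤ S.M → N ≤ j → a + b + 1 = N →
      ((S.p : ℤ) ^ (a + (j - N))) • S.c m ∉ S.A ℓ → ((S.p : ℤ) ^ b) • t ∉ S.A ℓ →
      P ⟨_, hz⟩ ⟨t, ht⟩ ≠ 0)
    (Δ : AddSubgroup V) (hΔp : ∀ d ∈ Δ, (S.p : ℤ) • d = 0)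
    (hΔpure : ∀ d ∈ Δ, ∀ e : ℤ, (e = 1 ∨ e = -1) → d ∈ S.eig e → d = 0)
    (hCeb₂ : ∀ (T : Finset V) (g₁ g₂ : V) (ν : ℤ) (I : ℕ), (ν = 1 ∨ ν = -1) → g₁ ∈ S.eig ν →
      g₂ ∈ S.eig (-ν) → (∀ t ∈ T, ∃ e : ℤ, (e = 1 ∨ e = -1) ∧ t ∈ S.eig e) →
      -- `g₁` FULL: its bottom avoids `Δ ⊔ ⟨T⟩`
      (g₁ ≠ 0 → ((S.p : ℤ) ^ (S.expo g₁ - 1)) • g₁ ∉ Δ ⊔ AddSubgroup.closure (T : Set V)) →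
      -- `g₂` of local order `≥ p^I`: `p^{I-1} g₂ ∉ Δ + ⟨T⟩_{-ν} + ⟨T⟩_{ν}[p]` (relative criterion,
      -- `KolyvaginAdaptiveTwo.exists_characters_of_not_mem_add`)
      (1 ≤ I → ∀ d ∈ Δ, ∀ u ∈ AddSubgroup.closure (T : Set V), u ∈ S.eig (-ν) →
        ∀ v ∈ AddSubgroup.closure (T : Set V), v ∈ S.eig ν → (S.p : ℤ) • v = 0 →
        ((S.p : ℤ) ^ (I - 1)) • g₂ ≠ d + u + v) →
      ∀ b : ℕ, ∃ ℓ, b < ℓ ∧ S.Kol ℓ ∧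
        (∀ t ∈ AddSubgroup.closure (T : Set V), t ∈ S.A ℓ) ∧
        (∀ j < S.expo g₁, ((S.p : ℤ) ^ j) • g₁ ∉ S.A ℓ) ∧
        (∀ i < I, ((S.p : ℤ) ^ i) • g₂ ∉ S.A ℓ))
    (Zp Zm : AddSubgroup V) [Finite Zp] [Finite Zm]
    (hZp : ∀ z ∈ Zp, z ∈ S.Sel ∧ z ∈ S.eig S.ε) (hZm : ∀ z ∈ Zm, z ∈ S.Sel ∧ z ∈ S.eig (-S.ε))
    (hiso : ∀ u, ∀ hu : u ∈ Zp ⊔ Zm, ∀ v, ∀ hv : v ∈ Zp ⊔ Zm, ∀ (hu' : u ∈ S.Sel) (hv' : v ∈ S.Sel),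
      P ⟨u, hu'⟩ ⟨v, hv'⟩ = 0)
    (hind : AddSubgroup.zmultiples S.x ⊓ (Zp ⊔ Zm) = ⊥)
    (hIND : (Zp ⊔ Δ) ⊓ Zm = ⊥)
    (hroom : ∀ z ∈ Zp ⊔ Zm, S.expo z + S.M₀ ≤ S.M) :
    Nat.card Zp * Nat.card Zm ≤ S.p ^ S.M₀ := by
  sorry

/-!
## Proof plan for the next seat (induction invariant; cf. gk2's `exists_chain_of_casselsTate_pure`)

State after `k` steps: a chain `n` (`KolSupp`, `k` prime factors), a used exponent sum `Σ`, and
POOLS `A ≤ Zside₁`, `B ≤ Zside₂` (the not-yet-used parts of `Zp`, `Zm`; which one is ACTIVE at the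
next step is decided by the sign `ν = ε(-1)^{k+1}`: active = the pool inside `eig ν`; `c(n) ∈ eig(-ν)`
is on the PASSIVE side), with
* (inv1) `∀ q ∈ n.primeFactors, ∀ z ∈ A ⊔ B, z ∈ S.A q` (McCallum (19)/(23));
* (inv2) = gk2's invariant (I): `p^i • c(n) ∈ A ⊔ B → (M − M₀) + Σ ≤ i`;
* (inv3) `#A · #B · p^Σ = #Zp · #Zm`;
* (inv4) (IND) `Disjoint Act (Pas ⊔ Δ)` (equivalently with the roles exchanged, since `Δ ∩ V^± = 0`).
Step (active pool `Act ≠ ⊥`): let `I := (M − M₀) + Σ` and `β := p^{I−1} • c(n)`. (F1): `β ∉ Pas ⊔ Δ`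
(a pure element of `Pas ⊔ Δ` lies in `Pas ⊆ A ⊔ B`, contradicting (inv2) at `i = I − 1`). Apply
`KolyvaginAdaptiveTwo.exists_split_not_mem_sup` with `Z := Act`, `Y := Pas ⊔ Δ`, `β`: get
`Act = ⟨z⟩ ⊕ Z′`, `ord z = exp Act`, `β ∉ Z′ ⊔ Pas ⊔ Δ`, no non-zero multiple of `z` in `Z′ ⊔ Pas ⊔ Δ`,
`Z′` disjoint from `Pas ⊔ Δ` (= (inv4) for the next step). Call `hCeb₂` with `T :=` (the finite set
`Z′ ∪ Pas`, all pure), `g₁ := z`, `g₂ := c(n)`, `I`: its two hypotheses are exactly the two outputs of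
the step lemma (`⟨T⟩ ∩ eig(−ν) = Pas`, `⟨T⟩ ∩ eig ν = Z′`). With the prime `ℓ`: `n′ := ℓ n`,
`Σ′ := Σ + expo z`, pools `(Z′, Pas)`; (inv1) from `⟨T⟩ ⊆ S.A ℓ`; (inv2) for `n′` VERBATIM as in gk2
(Fact B from `p^i c(n) ∉ S.A ℓ` for `i < I`; then `hCTV` with `t := z` — `z ∈ Sel`, pure, in `S.A q` for
`q ∣ n` by (inv1), full at `λ` — and isotropy of `z` against `Z′ ⊔ Pas ⊆ Zp ⊔ Zm`); (inv3) from
`#Act = ord z · #Z′`. Dummy step (`Act = ⊥`, `Pas ≠ ⊥`): `hCeb₂` with `g₁ := 0`; `Σ`, pools unchanged,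
roles swap; (inv2) for `ℓ n` from Fact B alone. Termination: measure `#A · #B` drops at every
non-dummy step and two consecutive steps are never both dummy. End (`A = B = ⊥`): (inv2) at `i = M`
gives `Σ ≤ M₀`, (inv3) gives `#Zp · #Zm = p^Σ`.
-/

end Literature.NumberTheory.EllipticCurves.KolyvaginDescent.SplitHypothesesM
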